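import Summits.SmoothPoincare4.SmoothPoincare4.Theorems.ConvexBisectionAcyclicBisectionExistsTwistDiffeo
import HarnessLib

/-!
# N1-move, bridge (e×) `piece_e_cross`, tool 6: an N1a-presented page Dehn twist along the core of a
# ROTATION FAMILY of annulus charts, on a page of ANY direction (wave 8, worker J4, brick of stub
# `stub_M2geo` = node N1 ▸ contract `node_N1_move_of_pieces` ▸ `HD` = `piece_e_cross piece_d`, line
# `modp-braid-orbits`, crux `ConvexBisection.AcyclicBisectionExists`, item stmt-SmoothPoincare4-10508;
# registered sub-goal `helper_exists_pageTwist_of_family`)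

Node N1a (`shadow_pageDehnTwist_eq_transvection`) and the bridge's `helper_shadow_twistReading` consume a
page Dehn twist PRESENTED in an annulus chart `φ₀` of `page g c`: a continuous self-map `τ` of `Base g`
with `τ (φ₀ (u, r)) = φ₀ (u ± β r, r)` on the strip and `τ = id` on the rest of the page.  G6's ambient
twist (`helper_twistAmb_package`, `…TwistAmbientMap.lean`) provides such a `τ` for charts of the page of
direction `1` only.  For the chart family of the bridge — H4's ORIENTED ROTATION FAMILY
`φ (u, r, σ) = R_{σ/κ} (φ (u, r, 0))` of charts of the pages `c e^{iσ}` (`helper_exists_orientedChartFamily`)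
— this file transports G6's twist to the belt page: with `σ₁ = −arg c` the level `φ_{σ₁}` is an N1a chart
of `page g 1`, G6's recipe gives the twist `τ₁` there (shear formula on the FULL-width chart, identity off
its open annulus), and **`τ = R_{−σ₁/κ} ∘ τ₁ ∘ R_{σ₁/κ}` is an N1a-presented twist for the level-`0`
chart `φ₀ = φ (·, ·, 0)` of `page g c`** (`exists_pageTwist_of_family`), with the profile
`β r = smoothTransition (2r + 1/2)`.

Everything is proved; no definitions, no named facts, no `sorry`.  Reference: B. Farb, D. Margalit,
*A primer on mapping class groups* (2012), §3.1.1 [FarbMargalit2012]. [folklore]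
-/

noncomputable section

set_option linter.dupNamespace false

open scoped Manifold ContDiff Topology Real
open Set Function Filter

namespace Summit.SmoothPoincare4.SmoothPoincare4.Theorems.AcyclicBisectionExists.ModpBraidOrbits

open Literature.Topology.FourManifolds Literature.Topology.FourManifolds.LefschetzBase

namespace CrossTwistMap

variable {g : ℕ}

/-- **An N1a-presented page Dehn twist along the core of an oriented rotation family**, on the page of
any unit direction `c` (see the module docstring). [cite: FarbMargalit2012, §3.1.1] -/
theorem exists_pageTwist_of_family {c : ℂ} (hc : ‖c‖ = 1) (R : AmbientIsotopy (𝓡∂ 4) (Base g)) {κ : ℝ}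
    (hκ : κ ≠ 0) (hRflow : ∀ (t s : ℝ) (p : Base g), R.toFun t (R.toFun s p) = R.toFun (t + s) p)
    (hRpage : ∀ (t : ℝ) (c' : ℂ) (p : Base g), p ∈ page g c' →
      R.toFun t p ∈ page g (c' * Complex.exp (((κ * t : ℝ) : ℂ) * Complex.I)))
    (φ : ℝ × ℝ × ℝ → Base g) (hrot : ∀ u r σ, φ (u, r, σ) = R.toFun (σ / κ) (φ (u, r, 0)))
    (hφs : ContMDiff 𝓘(ℝ, ℝ × ℝ × ℝ) (𝓡∂ 4) ∞ φ) (hφ1 : ∀ u r σ, φ (u + 1, r, σ) = φ (u, r, σ))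
    (hφp : ∀ (u r σ : ℝ), φ (u, r, σ) ∈ page g (c * Complex.exp ((σ : ℂ) * Complex.I)))
    (hφi : ∀ σ : ℝ, InjOn (fun p : ℝ × ℝ => φ (p.1, p.2, σ)) (Ico (0 : ℝ) 1 ×ˢ Ioo (-1 : ℝ) 1))
    (hφo : ∀ (u r σ : ℝ), r ∈ Ioo (-1 : ℝ) 1 →
      0 < inner ℝ (deriv (fun r' => (φ (u, r', σ)).1) r) (cplxJ (deriv (fun u' => (φ (u', r, σ)).1) u)))
    (s : Bool) :
    ∃ (τ : Base g → Base g) (β : ℝ → ℝ), Continuous τ ∧ ContDiff ℝ ∞ β ∧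
      (∀ r ≤ -(1 / 2 : ℝ), β r = 0) ∧ (∀ r ≥ (1 / 2 : ℝ), β r = 1) ∧
      (∀ u r, r ∈ Ioo (-1 : ℝ) 1 → τ (φ (u, r, 0)) = φ (u + (if s then β r else -β r), r, 0)) ∧
      (∀ p ∈ page g c, p ∉ (fun q : ℝ × ℝ => φ (q.1, q.2, 0)) '' (univ ×ˢ Ioo (-1 : ℝ) 1) → τ p = p) := by
  have hflow_neg : ∀ (t : ℝ) (p : Base g), R.toFun (-t) (R.toFun t p) = p := fun t p => by
    rw [hRflow, neg_add_cancel, R.map_zero, id]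
  have hflow_neg' : ∀ (t : ℝ) (p : Base g), R.toFun t (R.toFun (-t) p) = p := fun t p => by
    rw [hRflow, add_neg_cancel, R.map_zero, id]
  -- the level `σ₁ = −arg c` of the family is a chart of the page of direction `1`
  set σ₁ : ℝ := -Complex.arg c with hσ₁
  have hc1 : c * Complex.exp ((σ₁ : ℂ) * Complex.I) = 1 := by
    have h : Complex.exp ((Complex.arg c : ℂ) * Complex.I) = c := by
      have := Complex.norm_mul_exp_arg_mul_I c
      rwa [hc, Complex.ofReal_one, one_mul] at this
    have hc0 : c ≠ 0 := fun h0 => by rw [h0, norm_zero] at hc; exact zero_ne_one hc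
    rw [hσ₁, Complex.ofReal_neg, neg_mul, Complex.exp_neg, h, mul_inv_cancel₀ hc0]
  set φ₁ : ℝ × ℝ → Base g := fun p => φ (p.1, p.2, σ₁) with hφ₁
  have hφ₁s : ContMDiff 𝓘(ℝ, ℝ × ℝ) (𝓡∂ 4) ∞ φ₁ :=
    hφs.comp (contDiff_fst.prodMk (contDiff_snd.prodMk contDiff_const)).contMDiff
  have hφ₁1 : ∀ u r, φ₁ (u + 1, r) = φ₁ (u, r) := fun u r => hφ1 u r σ₁
  have hφ₁p : ∀ p, φ₁ p ∈ page g 1 := fun p => by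
    have h := hφp p.1 p.2 σ₁
    rwa [hc1] at h
  have hφ₁i : InjOn φ₁ (Ico (0 : ℝ) 1 ×ˢ Ioo (-1 : ℝ) 1) := hφi σ₁
  have hφ₁o : ∀ u r, r ∈ Ioo (-1 : ℝ) 1 →
      0 < inner ℝ (deriv (fun r' => (φ₁ (u, r')).1) r) (cplxJ (deriv (fun u' => (φ₁ (u', r)).1) u)) :=
    fun u r hr => hφo u r σ₁ hr
  -- G6's recipe on the page of direction `1`
  set Φ : ℝ × ℝ → EuclideanSpace ℝ (Fin 4) := fun p => (φ₁ p).1 with hΦ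
  have hΦs : ContDiff ℝ ∞ Φ := contDiff_val_of_chart hφ₁s
  have hΦw : ∀ p, w g (Φ p) = 1 / 2 := w_val_chart hφ₁p
  have hΦ1 : ∀ u r, Φ (u + 1, r) = Φ (u, r) := fun u r => by simp only [hΦ, hφ₁1]
  have hΦi : ∀ p p' : ℝ × ℝ, p.2 ∈ Ioo (-1 : ℝ) 1 → p'.2 ∈ Ioo (-1 : ℝ) 1 → Φ p = Φ p' →
      p.2 = p'.2 ∧ ∃ n : ℤ, p'.1 = p.1 + n := val_chart_eq_imp hφ₁1 hφ₁i
  have hΦd : ∀ p : ℝ × ℝ, p.2 ∈ Ioo (-1 : ℝ) 1 → Injective (fderiv ℝ Φ p) := fun p hp =>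
    injective_fderiv_of_chart hφ₁s hφ₁o (u := p.1) hp
  obtain ⟨M, hM2, hM⟩ := exists_bound_cx hφ₁1 hφ₁p hφ₁s.continuous
  set εm : ℝ := min (1 / 4) ((2 - M) / 4) with hεm
  have hε0 : 0 < εm := lt_min (by norm_num) (by linarith)
  have hε2 : εm < 1 / 2 := (min_le_left _ _).trans_lt (by norm_num)
  have hM0 : 0 ≤ M := (norm_nonneg _).trans (hM (0, 0) ⟨by norm_num, by norm_num⟩)
  have hMε : (1 + εm) * M < 2 := by
    have h1 : εm ≤ (2 - M) / 4 := min_le_right _ _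
    nlinarith
  set sg : ℝ := if s then 1 else -1 with hsg
  have hsg' : sg = 1 ∨ sg = -1 := by cases s <;> simp [hsg]
  set βh : ℝ → ℝ := fun r => Real.smoothTransition (2 * r + 1 / 2) with hβh
  obtain ⟨hβ, hβ0, hβ1⟩ := twistProfile_props
  obtain ⟨hsm, hrho, -, -, hon, hoff⟩ :=
    helper_twistAmb_package g Φ εm sg M βh hΦs hΦw hΦ1 hΦi hΦd hε0 hε2 hsg' hβ hβ0 hβ1 hM hMε
  -- the twist of the base along the level `σ₁`
  have hmem : ∀ x : Base g, rho g (twistAmb g Φ εm sg βh x.1) ≤ 1 / 4 := fun x => by rw [hrho]; exact x.2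
  set τD : Base g → Base g := fun x =>
    RegularSublevel.mk (isRegularLevel_rho g) (twistAmb g Φ εm sg βh x.1) (hmem x) with hτD
  have hτDval : ∀ x : Base g, (τD x).1 = twistAmb g Φ εm sg βh x.1 := fun x => rfl
  have hτDc : Continuous τD := by
    have h1 : Continuous fun x : Base g => twistAmb g Φ εm sg βh x.1 :=
      continuous_iff_continuousAt.2 fun x =>
        (hsm x.1 x.2).continuousAt.comp continuous_subtype_val.continuousAt
    exact continuous_induced_rng.2 h1
  have hdom : ∀ u r : ℝ, r ∈ Ioo (-1 : ℝ) 1 → (((1 / 2 : ℂ)), (u, r)) ∈ twistDom εm := fun u r hr =>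
    ⟨by rw [show (2 : ℂ) * (1 / 2) = 1 by norm_num, norm_one]; linarith, hr⟩
  have hformula : ∀ u r : ℝ, r ∈ Ioo (-1 : ℝ) 1 →
      twistAmb g Φ εm sg βh (Φ (u, r)) = Φ (u + sg * βh r, r) := fun u r hr => by
    have h := hon _ (hdom u r hr)
    rw [prodChart_half] at h
    rw [h, show shearMap sg βh ((1 / 2 : ℂ), (u, r)) = ((1 / 2 : ℂ), (u + sg * βh r, r)) from rfl,
      prodChart_half]
  have hτDon : ∀ u r, r ∈ Ioo (-1 : ℝ) 1 → τD (φ₁ (u, r)) = φ₁ (u + sg * βh r, r) := fun u r hr =>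
    Subtype.ext (by rw [hτDval]; exact hformula u r hr)
  have hτDoff : ∀ q ∈ page g 1, q ∉ φ₁ '' (univ ×ˢ Ioo (-1 : ℝ) 1) → τD q = q := by
    intro q hq hqn
    apply Subtype.ext
    rw [hτDval]
    apply hoff
    rintro ⟨q', hq', hq'q⟩
    have hw1 : q'.1 = 1 / 2 := by
      have hw : w g q.1 = 1 / 2 := hq.2
      rwa [← hq'q, w_prodChart hΦw] at hw
    apply hqn
    refine ⟨q'.2, ⟨trivial, hq'.2⟩, Subtype.ext ?_⟩
    show Φ q'.2 = q.1
    rw [← hq'q, show q' = ((1 / 2 : ℂ), q'.2) from Prod.ext hw1 rfl, prodChart_half]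
  -- conjugate by the rotation between the levels `0` and `σ₁`
  have hφ₁rot : ∀ u r, φ₁ (u, r) = R.toFun (σ₁ / κ) (φ (u, r, 0)) := fun u r => hrot u r σ₁
  refine ⟨fun p => R.toFun (-(σ₁ / κ)) (τD (R.toFun (σ₁ / κ) p)), βh, ?_, hβ, fun r hr => hβ0 r (by linarith),
    fun r hr => hβ1 r (by linarith), fun u r hr => ?_, fun p hp hpn => ?_⟩
  · have hRc : Continuous (uncurry R.toFun) := R.contMDiff.continuous
    exact (hRc.comp (continuous_const.prodMk continuous_id)).comp
      (hτDc.comp (hRc.comp (continuous_const.prodMk continuous_id)))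
  · show R.toFun (-(σ₁ / κ)) (τD (R.toFun (σ₁ / κ) (φ (u, r, 0)))) = φ (u + (if s then βh r else -βh r), r, 0)
    rw [← hφ₁rot, hτDon u r hr, hφ₁rot, hflow_neg]
    cases s <;> simp [hsg]
  · show R.toFun (-(σ₁ / κ)) (τD (R.toFun (σ₁ / κ) p)) = p
    have hq : R.toFun (σ₁ / κ) p ∈ page g 1 := by
      have h := hRpage (σ₁ / κ) c p hp
      rwa [show κ * (σ₁ / κ) = σ₁ by field_simp, hc1] at h
    have hqn : R.toFun (σ₁ / κ) p ∉ φ₁ '' (univ ×ˢ Ioo (-1 : ℝ) 1) := by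
      rintro ⟨q, hq2, hqp⟩
      apply hpn
      refine ⟨q, hq2, ?_⟩
      show φ (q.1, q.2, 0) = p
      have e1 : φ₁ q = R.toFun (σ₁ / κ) (φ (q.1, q.2, 0)) := hrot q.1 q.2 σ₁
      rw [← hflow_neg (σ₁ / κ) (φ (q.1, q.2, 0)), ← e1, hqp, hflow_neg]
    rw [hτDoff _ hq hqn, hflow_neg]

end CrossTwistMap

open CrossTwistMap

/-! ## The registered form -/

/-- **Sub-goal `helper_exists_pageTwist_of_family`** (J4, bridge (e×) of the N1 contract, tool 6, fully
qualified): along the core of an oriented rotation family of annulus charts of the pages `c e^{iσ}` there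
is an N1a-presented page Dehn twist for the level-`0` chart of `page g c` (G6's ambient twist transported
from the page of direction `1`). [cite: FarbMargalit2012, §3.1.1] -/
theorem helper_exists_pageTwist_of_family : ∀ (g : ℕ) (c : ℂ) (R : Literature.Topology.FourManifolds.AmbientIsotopy (𝓡∂ 4) (Literature.Topology.FourManifolds.LefschetzBase.Base g)) (κ : ℝ) (φ : ℝ × ℝ × ℝ → Literature.Topology.FourManifolds.LefschetzBase.Base g) (s : Bool), ‖c‖ = 1 → κ ≠ 0 → (∀ (t s : ℝ) (p : Literature.Topology.FourManifolds.LefschetzBase.Base g), R.toFun t (R.toFun s p) = R.toFun (t + s) p) → (∀ (t : ℝ) (c' : ℂ) (p : Literature.Topology.FourManifolds.LefschetzBase.Base g), p ∈ Literature.Topology.FourManifolds.LefschetzBase.page g c' → R.toFun t p ∈ Literature.Topology.FourManifolds.LefschetzBase.page g (c' * Complex.exp (((κ * t : ℝ) : ℂ) * Complex.I))) → (∀ u r σ, φ (u, r, σ) = R.toFun (σ / κ) (φ (u, r, 0))) → ContMDiff 𝓘(ℝ, ℝ × ℝ × ℝ) (𝓡∂ 4) ∞ φ → (∀ u r σ,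 φ (u + 1, r, σ) = φ (u, r, σ)) → (∀ (u r σ : ℝ), φ (u, r, σ) ∈ Literature.Topology.FourManifolds.LefschetzBase.page g (c * Complex.exp ((σ : ℂ) * Complex.I))) → (∀ σ : ℝ, Set.InjOn (fun p : ℝ × ℝ => φ (p.1, p.2, σ)) (Set.Ico (0 : ℝ) 1 ×ˢ Set.Ioo (-1 : ℝ) 1)) → (∀ (u r σ : ℝ), r ∈ Set.Ioo (-1 : ℝ) 1 → 0 < inner ℝ (deriv (fun r' => (φ (u, r', σ)).1) r) (Literature.Topology.FourManifolds.LefschetzBase.cplxJ (deriv (fun u' => (φ (u', r, σ)).1) u))) → ∃ (τ : Literature.Topology.FourManifolds.LefschetzBase.Base g → Literature.Topology.FourManifolds.LefschetzBase.Base g) (β : ℝ → ℝ), Continuous τ ∧ ContDiff ℝ ∞ β ∧ (∀ r ≤ -(1 / 2 : ℝ), β r = 0) ∧ (∀ r ≥ (1 / 2 : ℝ), β r = 1) ∧ (∀ u r, r ∈ Set.Ioo (-1 : ℝ) 1 → τ (φ (u, r, 0)) = φ (u + (if s then β r else -β r), r, 0)) ∧ (∀ p ∈ Literature.Topology.FourManifolds.LefschetzBase.page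 g c, p ∉ (fun q : ℝ × ℝ => φ (q.1, q.2, 0)) '' (Set.univ ×ˢ Set.Ioo (-1 : ℝ) 1) → τ p = p) :=
  fun _ _ R _ φ s hc hκ hRflow hRpage hrot hφs hφ1 hφp hφi hφo =>
    exists_pageTwist_of_family hc R hκ hRflow hRpage φ hrot hφs hφ1 hφp hφi hφo s

end Summit.SmoothPoincare4.SmoothPoincare4.Theorems.AcyclicBisectionExists.ModpBraidOrbits

end
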